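import Literature.MathematicalPhysics.QuantumFieldTheory.Balaban1983to89.B11Prop7AssemblyThresholds
import Literature.MathematicalPhysics.QuantumFieldTheory.Balaban1983to89.B11SectFAssembly
import Literature.MathematicalPhysics.QuantumFieldTheory.Balaban1983to89.B11Thm1

/-!
# `Balaban1983to89.B11LeafKnitFull` — T. Bałaban, *The variational problem and background fields in renormalization group method for
# lattice gauge theories*, Commun. Math. Phys. **102** (1985) 277–309, doi:10.1007/bf01229381 [Balaban1985Variational]: **the B11 leaf and
# the DAG node N07 from Propositions 2–6, 9 and the LOCATED LEAVES ONLY** — Proposition 8 (p. 304) and the Sect. F regularity conclusion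
# (p. 305) are no longer inputs but come from the located leaves of Sect. F (`B11SectFAssembly.Leaves`: (152)/(165), (1.141)–(1.142) of [6],
# locality of (2), (1.36) of [6]) BY NAME (`B11SectFAssembly.prop8Printed_of_leaves`, `sectFPrinted_of_leaves`, reader r08 gen 8), the
# existence steps of pp. 296–299 enter THRESHOLDED (`B11Prop7AssemblyThresholds`), and over the scale tower the Sect. A law is the induction

statement-level bookkeeping over published theorems with citation tags; proofs = kernel composition of landed modules BY NAME; nothing here
is a claim about the Yang–Mills mass gap

PDF held: `paper:balaban1985-cmp102-variational-background` (journal page = PDF page + 276).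

CITATION HEADER (lean-in-tree rule 2026-08-18) / WHAT IS REPRODUCED.  Cell `pub-ymgap`, Track A node N07 = [B11] (`Dag.B11_main` = «b5 → b6 →
b7 → b8 → b9 → b11», own leaf `DagBinding.B11Leaf Z`), prover seat `pub-ymgap-dag-n07-a` (KNIT-BY-NAME), sixth module — THE MOST REDUCED PIN
LIST: of the ten conjuncts of `B11Leaf`, Theorem 1, Propositions 7, 8 and the Sect. F conclusion are DERIVED (their printed proofs are
Sects. A–F of this paper, assembled in the tree), so the inputs are the SIX printed statements whose proofs rest on the cited papers' operator
theory — Props 2 (⇐ [6] Thm 2, `B11LeafKnit` §3 / `B11LeafKnitB8Edge`), 3, 4, 5, 6 ([4], [5], [3]), 9 (Sect. G) — plus LOCATED LEAVES with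
their verbatim sentences (never asserted): the Theorem-1 carrier laws, the bridge famX ↔ famLG with (15)–(18), the three existence steps
(112)/(123)–(142) for ε₁, ε₂ ≤ c, the Sect. A law for ε₁ ≤ a (generic bundle) resp. the Sect. A leaves (11) ⇒ (7), (12) ⇒ (13), k = 1
(tower), and `B11SectFAssembly.Leaves` (Sect. F).  A NEW LEAF over `B11Prop7AssemblyThresholds` (the seat's module 4),
`B11SectFAssembly`, `B11Thm1`; nothing there is modified; NO definition (theorems only).
§1 `prop8_sectF_of_leavesF`: Prop 8 ∧ Sect. F on a family from `Leaves` per member (`prop8Printed_of_leaves` + `sectFPrinted_of_leaves`, the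
   monotonicity of the spaces (2) taken from `VarProblemX.Laws`); `b11Leaf_of_parts_full`, `b11_main_of_parts_full`: the leaf of a bundle `Z`
   and the node at a run `w.up P = Upstream.ofPrintedAllXPN X Y Z V W` from Props 2, 3, 4, 5, 6, 9 + located leaves.
§2 `prop7From14_tower_thr`, `b11Leaf_tower_full`, `b11_main_tower_full`: the same over the printed scale tower `B11Thm1.Tower` (Sect. A law =
   the induction, `B11Thm1.thm1At_allLevels` / `background_of_thm1At` BY NAME; existence steps thresholded; Sect. F from `Leaves` over all
   levels).  LOCATED CAVEAT carried by name: pv12's leaf `StepA11` is REFUTED in the multi-domain case (cell GAPS G-B11-A1b; repaired tower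
   `B11Thm1TwoTier`, knit `B11LeafKnitTwoTier`).
CONSTANTS: the Sect.-F leaves are taken at the leaf's own B₁ ([6] Thm 2), B₃ ((162)), c₁ ([6] Thm 2 threshold), with B₂ = B₂(β₀) ([6] (1.36)),
K ((165)–(166)), R₁M₁ ((144)), a₃ (Prop. 4), a₄ (Prop. 6), d, L as in `B11SectFAssembly`; B₄ = 9dL²B₂B₃ and M(ε₁) = R₁M₁(a₁/ε₁) come out as
printed (p. 279).  **Prop 9 `B11.Prop9Printed`: inhabited on a Sect. E–G MODEL family (`B11Prop9Model`, seat dag-n07-b), conditional on its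
`Letters` ((189) omitted in print, GAPS G-B11-G2); the Hölder leaf `holder136` at β₀ = 1 vs [6] (1.36) for β₀ < 1 (GAPS G-B11-F3); (166′) repaired 1/16 (GAPS G-B11-02).**
HONEST FRAMING: a count-neutral Track-A side landing (YM-PLAN §1); NOT a discharge of node N07 (the B11 group is FREE at NODE 00 Stages 1–3,
`Node00.IsWorldOfRecord₃`); one finite T⁴ programme at fixed ε; Bałaban AS PRINTED with page locators; nothing continuum / ℝ⁴ / OS /
mass-gap / Clay.
-/

namespace Literature.MathematicalPhysics.QuantumFieldTheory.Balaban1983to89.B11LeafKnitFull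

open Literature.MathematicalPhysics.QuantumFieldTheory.Balaban1983to89
open Literature.MathematicalPhysics.QuantumFieldTheory.Balaban1983to89.B11
open Literature.MathematicalPhysics.QuantumFieldTheory.Balaban1983to89.B11Thm1
open Literature.MathematicalPhysics.QuantumFieldTheory.Balaban1983to89.DagBinding
open Literature.MathematicalPhysics.QuantumFieldTheory.Balaban1983to89.B11Prop7Assembly (Bridge)
open Literature.MathematicalPhysics.QuantumFieldTheory.Balaban1983to89.B11SectFAssembly (CubeData Leaves)
open Literature.MathematicalPhysics.QuantumFieldTheory.Balaban1983to89.B11Prop7AssemblyThresholds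
  (prop7Printed_of_props_thr prop7From14_of_props_thr)

variable {I : Type}

/-! ## §1. Prop 8 and Sect. F from the located leaves of Sect. F; the leaf and the node of a bundle -/

/-- **Proposition 8 (p. 304) and the Sect. F regularity conclusion (p. 305) on a family, from the located leaves of Sect. F per member** —
`B11SectFAssembly.prop8Printed_of_leaves` (the halving iteration of p. 304 over the first case with the repaired (166′)) and
`B11SectFAssembly.sectFPrinted_of_leaves` (the second case, B₄ = 9dL²B₂B₃, M(ε₁) = R₁M₁(a₁/ε₁)) BY NAME; the monotonicity of the spaces (2) is
the first Theorem-1 carrier law. [cite: Balaban1985Variational, Prop. 8 p.304, Sect. F (169) p.305] -/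
theorem prop8_sectF_of_leavesF (fam : I → VarProblemX) (D : ∀ i, CubeData (fam i)) {d L B₁ B₂ B₃ K R₁M₁ c₁ a₃ a₄ : ℝ}
    (hLv : ∀ i, Leaves (fam i) (D i) d L B₁ B₂ B₃ K R₁M₁ c₁ a₃ a₄) (plaws : ∀ i, (fam i).Laws)
    (hd : 1 ≤ d) (hL : 0 < L) (hB₁ : 0 < B₁) (hB₂ : 0 < B₂) (hB₃ : 0 < B₃) (hK : 0 < K) (hR : 1 ≤ R₁M₁) (hc₁ : 0 < c₁)
    (ha₃ : 0 < a₃) (ha₄ : 0 < a₄) :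
    Prop8Printed B₃ fam ∧ SectFPrinted B₃ fam :=
  ⟨B11SectFAssembly.prop8Printed_of_leaves fam D hLv hd hL hB₁ hB₃ hK (by linarith) hc₁ ha₃ ha₄ fun i => (plaws i).1,
    B11SectFAssembly.sectFPrinted_of_leaves fam D hLv (by linarith) hL hB₁ hB₂ hB₃ hK hR hc₁ ha₃ ha₄⟩

section Bundle

variable (Z : PrintedCarriers11)

/-- **THE B11 LEAF FROM PROPS 2, 3, 4, 5, 6, 9 AND THE LOCATED LEAVES ONLY.**  Of the ten conjuncts of `DagBinding.B11Leaf Z`: p8, sF by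
`prop8_sectF_of_leavesF` (Sect. F leaves at the leaf's constants B₁, B₃, c₁), p7 by `B11Prop7AssemblyThresholds.prop7Printed_of_props_thr`
(Props 2, 5, 6 + bridge laws (15)–(18) + the existence steps for ε₁, ε₂ ≤ c + the Sect. A law for ε₁ ≤ a), t1 by `B11.thm1_of_prop7_prop8_sectF`
(for `Z.famV = fun i ↦ (Z.famX i).toVarProblem`); p2 p3 p4 p5 p6 p9 enter verbatim. [cite: Balaban1985Variational, Thm 1 p.279, Props 2–9 pp.281–309] -/
theorem b11Leaf_of_parts_full (β : ∀ i, Bridge (Z.famX i) (Z.famLG i)) {O₁ O₂ e₅ c a d L B₂ K R₁M₁ a₃ a₄ : ℝ}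
    (laws : ∀ i, (β i).Laws Z.C₁ Z.B₃)
    (crit112 : ∀ (i : Z.I11) (ε₁ : ℝ) (V : (Z.famX i).Bdry) (U₀ : (Z.famLG i).Cfg) (A₁ : (Z.famLG i).Fld), 0 < ε₁ → ε₁ ≤ c →
      (Z.famLG i).Sat14 (Z.C₁ * Z.B₃ * ε₁) (Z.C₁ * ε₁) ((β i).bdry V) U₀ → (Z.famLG i).Sol111 ((β i).bdry V) U₀ A₁ →
      (Z.famLG i).nMax U₀ A₁ < 3 * Z.B₀ * Z.C₁ * Z.B₃ * ε₁ →
        (Z.famLG i).CritL ((β i).bdry V) U₀ ((Z.famLG i).T112 ((β i).bdry V) U₀ A₁) ∧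
          (Z.famLG i).In19_21 (O₁ * Z.C₁ * Z.B₃ * ε₁) ((β i).bdry V) U₀ ((Z.famLG i).T112 ((β i).bdry V) U₀ A₁))
    (axial18 : ∀ (i : Z.I11) (ε₁ ε₂ : ℝ) (V : (Z.famX i).Bdry) (U₀ : (Z.famLG i).Cfg) (U₁ : (Z.famLG i).Pert),
      0 < ε₁ → ε₁ ≤ c → 0 < ε₂ → ε₂ ≤ c →
      (Z.famLG i).Sat14 (Z.C₁ * Z.B₃ * ε₁) (Z.C₁ * ε₁) ((β i).bdry V) U₀ → (Z.famLG i).In19_21 ε₂ ((β i).bdry V) U₀ U₁ →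
      (Z.famLG i).CritL ((β i).bdry V) U₀ U₁ →
        ∃ u : (Z.famLG i).GT, (Z.famLG i).Restricted U₀ u ∧
          (Z.famX i).InU (O₂ * ε₂) ((β i).emb U₀ ((Z.famLG i).toAxial U₀ U₁ u)) ∧
          (Z.famX i).InB V ((β i).emb U₀ ((Z.famLG i).toAxial U₀ U₁ u)) ∧
          (Z.famX i).IsCritical V ((β i).emb U₀ ((Z.famLG i).toAxial U₀ U₁ u)))
    (minimal142 : ∀ (i : Z.I11) (e ε₁ : ℝ) (V : (Z.famX i).Bdry) (U₀ : (Z.famLG i).Cfg) (U₁ : (Z.famLG i).Pert)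
      (u : (Z.famLG i).GT), e ≤ e₅ → 0 < ε₁ → ε₁ ≤ c →
      (Z.famLG i).Sat14 (Z.C₁ * Z.B₃ * ε₁) (Z.C₁ * ε₁) ((β i).bdry V) U₀ → (Z.famLG i).CritL ((β i).bdry V) U₀ U₁ →
      (Z.famLG i).Restricted U₀ u → (Z.famX i).InU e ((β i).emb U₀ ((Z.famLG i).toAxial U₀ U₁ u)) →
      (Z.famX i).InB V ((β i).emb U₀ ((Z.famLG i).toAxial U₀ U₁ u)) →
      (Z.famX i).IsCritical V ((β i).emb U₀ ((Z.famLG i).toAxial U₀ U₁ u)) →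
        (Z.famX i).OnMinimalOrbit e V ((β i).emb U₀ ((Z.famLG i).toAxial U₀ U₁ u)))
    (plaws : ∀ i, (Z.famX i).Laws)
    (D : ∀ i, CubeData (Z.famX i)) (hLv : ∀ i, Leaves (Z.famX i) (D i) d L Z.B₁ B₂ Z.B₃ K R₁M₁ Z.c₁ a₃ a₄)
    (hd : 1 ≤ d) (hL : 0 < L) (hB₂ : 0 < B₂) (hK : 0 < K) (hR : 1 ≤ R₁M₁) (ha₃ : 0 < a₃) (ha₄ : 0 < a₄)
    (hB₀ : 0 < Z.B₀) (hB₁ : 0 < Z.B₁) (hB₃ : 1 ≤ Z.B₃) (hC₁ : 1 ≤ Z.C₁) (hB₀B₁ : Z.B₀ ≤ 4 * Z.B₁) (hc₁ : 0 < Z.c₁)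
    (hO₁ : 0 < O₁) (hO₂ : 0 < O₂) (he₅ : 0 < e₅) (hc : 0 < c) (ha : 0 < a)
    (hbg : ∀ (i : Z.I11) (ε₁ : ℝ) (V : (Z.famX i).Bdry), 0 < ε₁ → ε₁ ≤ a → (Z.famX i).Reg7 ε₁ V →
      ∃ U₀ : (Z.famLG i).Cfg, (Z.famLG i).Sat14 (Z.C₁ * Z.B₃ * ε₁) (Z.C₁ * ε₁) ((β i).bdry V) U₀)
    (hV : Z.famV = fun i => (Z.famX i).toVarProblem)
    (p2 : Prop2Printed Z.B₁ Z.B₃ Z.C₁ Z.c₁ Z.famLG) (p3 : Prop3Printed Z.C₁ Z.B₃ Z.C₂ Z.C₃ Z.B₀ Z.c1h Z.c₄ Z.δ₀ Z.famLG)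
    (p4 : Prop4Printed Z.C₁ Z.B₃ Z.famLG) (p5 : Prop5Printed Z.B₁ Z.B₃ Z.C₁ Z.famLG) (p6 : Prop6Printed Z.B₀ Z.B₃ Z.C₁ Z.famLG)
    (p9 : Prop9Printed Z.B₅ Z.C₁ Z.β₀ Z.δ₀ Z.famAn) :
    B11Leaf Z := by
  have hB₃pos : 0 < Z.B₃ := lt_of_lt_of_le one_pos hB₃
  obtain ⟨p8, sF⟩ := prop8_sectF_of_leavesF Z.famX D hLv plaws hd hL hB₁ hB₂ hB₃pos hK hR hc₁ ha₃ ha₄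
  have p7 : Prop7Printed Z.B₃ Z.C₁ Z.famX :=
    prop7Printed_of_props_thr β laws crit112 axial18 minimal142 hB₀ hB₁ hB₃ hC₁ hB₀B₁ hc₁ hO₁ hO₂ he₅ hc ha hbg p2 p5 p6
  have t1 : Thm1Printed Z.famV := by
    rw [hV]
    exact thm1_of_prop7_prop8_sectF Z.famX Z.B₃ Z.C₁ hB₃pos (lt_of_lt_of_le one_pos hC₁) plaws p7 p8 sF
  exact ⟨t1, p2, p3, p4, p5, p6, p7, p8, sF, p9⟩

/-- **THE NODE N07 FROM PROPS 2, 3, 4, 5, 6, 9 AND THE LOCATED LEAVES ONLY, AT A BINDING OF RECORD**: for every binding world and run with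
`w.up P = Upstream.ofPrintedAllXPN X Y Z V W`, the inputs of `b11Leaf_of_parts_full` at the run's B11 group `Z` give `Dag.B11_main (leavesP w P)`.
THE HYPOTHESIS LIST IS THE MOST REDUCED FORM OF WHAT A NODE-00 PIN OF THE B11 GROUP MUST CARRY FOR N07 (the antecedents b5 … b9 are not
consumed here; the b8 edge supplies p2, `B11LeafKnitB8Edge`). Nothing is discharged. [cite: Balaban1985Variational, Thm 1 p.279, Props 2–9 pp.281–309] -/
theorem b11_main_of_parts_full (w : WorldP) (P : B12.RunParams) (X : PrintedCarriersR) (Y : PrintedCarriers9X)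
    (V : PrintedCarriers14R) (W : PrintedCarriers15) (hP : w.up P = Upstream.ofPrintedAllXPN X Y Z V W)
    (β : ∀ i, Bridge (Z.famX i) (Z.famLG i)) {O₁ O₂ e₅ c a d L B₂ K R₁M₁ a₃ a₄ : ℝ}
    (laws : ∀ i, (β i).Laws Z.C₁ Z.B₃)
    (crit112 : ∀ (i : Z.I11) (ε₁ : ℝ) (V : (Z.famX i).Bdry) (U₀ : (Z.famLG i).Cfg) (A₁ : (Z.famLG i).Fld), 0 < ε₁ → ε₁ ≤ c →
      (Z.famLG i).Sat14 (Z.C₁ * Z.B₃ * ε₁) (Z.C₁ * ε₁) ((β i).bdry V) U₀ → (Z.famLG i).Sol111 ((β i).bdry V) U₀ A₁ →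
      (Z.famLG i).nMax U₀ A₁ < 3 * Z.B₀ * Z.C₁ * Z.B₃ * ε₁ →
        (Z.famLG i).CritL ((β i).bdry V) U₀ ((Z.famLG i).T112 ((β i).bdry V) U₀ A₁) ∧
          (Z.famLG i).In19_21 (O₁ * Z.C₁ * Z.B₃ * ε₁) ((β i).bdry V) U₀ ((Z.famLG i).T112 ((β i).bdry V) U₀ A₁))
    (axial18 : ∀ (i : Z.I11) (ε₁ ε₂ : ℝ) (V : (Z.famX i).Bdry) (U₀ : (Z.famLG i).Cfg) (U₁ : (Z.famLG i).Pert),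
      0 < ε₁ → ε₁ ≤ c → 0 < ε₂ → ε₂ ≤ c →
      (Z.famLG i).Sat14 (Z.C₁ * Z.B₃ * ε₁) (Z.C₁ * ε₁) ((β i).bdry V) U₀ → (Z.famLG i).In19_21 ε₂ ((β i).bdry V) U₀ U₁ →
      (Z.famLG i).CritL ((β i).bdry V) U₀ U₁ →
        ∃ u : (Z.famLG i).GT, (Z.famLG i).Restricted U₀ u ∧
          (Z.famX i).InU (O₂ * ε₂) ((β i).emb U₀ ((Z.famLG i).toAxial U₀ U₁ u)) ∧
          (Z.famX i).InB V ((β i).emb U₀ ((Z.famLG i).toAxial U₀ U₁ u)) ∧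
          (Z.famX i).IsCritical V ((β i).emb U₀ ((Z.famLG i).toAxial U₀ U₁ u)))
    (minimal142 : ∀ (i : Z.I11) (e ε₁ : ℝ) (V : (Z.famX i).Bdry) (U₀ : (Z.famLG i).Cfg) (U₁ : (Z.famLG i).Pert)
      (u : (Z.famLG i).GT), e ≤ e₅ → 0 < ε₁ → ε₁ ≤ c →
      (Z.famLG i).Sat14 (Z.C₁ * Z.B₃ * ε₁) (Z.C₁ * ε₁) ((β i).bdry V) U₀ → (Z.famLG i).CritL ((β i).bdry V) U₀ U₁ →
      (Z.famLG i).Restricted U₀ u → (Z.famX i).InU e ((β i).emb U₀ ((Z.famLG i).toAxial U₀ U₁ u)) →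
      (Z.famX i).InB V ((β i).emb U₀ ((Z.famLG i).toAxial U₀ U₁ u)) →
      (Z.famX i).IsCritical V ((β i).emb U₀ ((Z.famLG i).toAxial U₀ U₁ u)) →
        (Z.famX i).OnMinimalOrbit e V ((β i).emb U₀ ((Z.famLG i).toAxial U₀ U₁ u)))
    (plaws : ∀ i, (Z.famX i).Laws)
    (D : ∀ i, CubeData (Z.famX i)) (hLv : ∀ i, Leaves (Z.famX i) (D i) d L Z.B₁ B₂ Z.B₃ K R₁M₁ Z.c₁ a₃ a₄)
    (hd : 1 ≤ d) (hL : 0 < L) (hB₂ : 0 < B₂) (hK : 0 < K) (hR : 1 ≤ R₁M₁) (ha₃ : 0 < a₃) (ha₄ : 0 < a₄)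
    (hB₀ : 0 < Z.B₀) (hB₁ : 0 < Z.B₁) (hB₃ : 1 ≤ Z.B₃) (hC₁ : 1 ≤ Z.C₁) (hB₀B₁ : Z.B₀ ≤ 4 * Z.B₁) (hc₁ : 0 < Z.c₁)
    (hO₁ : 0 < O₁) (hO₂ : 0 < O₂) (he₅ : 0 < e₅) (hc : 0 < c) (ha : 0 < a)
    (hbg : ∀ (i : Z.I11) (ε₁ : ℝ) (V : (Z.famX i).Bdry), 0 < ε₁ → ε₁ ≤ a → (Z.famX i).Reg7 ε₁ V →
      ∃ U₀ : (Z.famLG i).Cfg, (Z.famLG i).Sat14 (Z.C₁ * Z.B₃ * ε₁) (Z.C₁ * ε₁) ((β i).bdry V) U₀)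
    (hV : Z.famV = fun i => (Z.famX i).toVarProblem)
    (p2 : Prop2Printed Z.B₁ Z.B₃ Z.C₁ Z.c₁ Z.famLG) (p3 : Prop3Printed Z.C₁ Z.B₃ Z.C₂ Z.C₃ Z.B₀ Z.c1h Z.c₄ Z.δ₀ Z.famLG)
    (p4 : Prop4Printed Z.C₁ Z.B₃ Z.famLG) (p5 : Prop5Printed Z.B₁ Z.B₃ Z.C₁ Z.famLG) (p6 : Prop6Printed Z.B₀ Z.B₃ Z.C₁ Z.famLG)
    (p9 : Prop9Printed Z.B₅ Z.C₁ Z.β₀ Z.δ₀ Z.famAn) :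
    Dag.B11_main (leavesP w P) := by
  show (w.up P).b5 → (w.up P).b6 → (w.up P).b7 → (w.up P).b8 → (w.up P).b9 → (w.up P).b11
  rw [hP]
  exact fun _ _ _ _ _ => b11Leaf_of_parts_full Z β laws crit112 axial18 minimal142 plaws D hLv hd hL hB₂ hK hR ha₃ ha₄ hB₀ hB₁ hB₃
    hC₁ hB₀B₁ hc₁ hO₁ hO₂ he₅ hc ha hbg hV p2 p3 p4 p5 p6 p9

end Bundle

/-! ## §2. The same over the printed scale tower: Sect. A law = the induction -/

section TowerFull

variable (T : Tower) (famD : (Σ n, T.I n) → LGData) (β : ∀ p : Σ n, T.I n, Bridge (T.famAllX p) (famD p))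
  (bg : ∀ p : Σ n, T.I n, (T.fam p.1 p.2).Cfg → (famD p).Cfg)

/-- **pv12's leaf `Prop7From14 T B₃ L³` from Props 2, 5, 6 with THRESHOLDED existence steps** (the tower form of
`B11Prop7AssemblyThresholds.prop7From14_of_props_thr`, the background read on the Sect. A–E carrier through `hbg14` = (14) p. 280).
[cite: Balaban1985Variational, Prop. 7 p.299; (14) p.280; (122) p.296] -/
theorem prop7From14_tower_thr {B₀ B₁ B₃ c₁ O₁ O₂ e₅ c : ℝ}
    (hbg14 : ∀ (p : Σ n, T.I n) (ε₁ : ℝ) (V : (T.fam p.1 p.2).Bdry) (U : (T.fam p.1 p.2).Cfg),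
      (T.fam p.1 p.2).Sat14 (T.L ^ 3) B₃ ε₁ V U → (famD p).Sat14 (T.L ^ 3 * B₃ * ε₁) (T.L ^ 3 * ε₁) ((β p).bdry V) (bg p U))
    (laws : ∀ p, (β p).Laws (T.L ^ 3) B₃)
    (crit112 : ∀ (p : Σ n, T.I n) (ε₁ : ℝ) (V : (T.famAllX p).Bdry) (U₀ : (famD p).Cfg) (A₁ : (famD p).Fld), 0 < ε₁ → ε₁ ≤ c →
      (famD p).Sat14 (T.L ^ 3 * B₃ * ε₁) (T.L ^ 3 * ε₁) ((β p).bdry V) U₀ → (famD p).Sol111 ((β p).bdry V) U₀ A₁ →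
      (famD p).nMax U₀ A₁ < 3 * B₀ * T.L ^ 3 * B₃ * ε₁ →
        (famD p).CritL ((β p).bdry V) U₀ ((famD p).T112 ((β p).bdry V) U₀ A₁) ∧
          (famD p).In19_21 (O₁ * T.L ^ 3 * B₃ * ε₁) ((β p).bdry V) U₀ ((famD p).T112 ((β p).bdry V) U₀ A₁))
    (axial18 : ∀ (p : Σ n, T.I n) (ε₁ ε₂ : ℝ) (V : (T.famAllX p).Bdry) (U₀ : (famD p).Cfg) (U₁ : (famD p).Pert),
      0 < ε₁ → ε₁ ≤ c → 0 < ε₂ → ε₂ ≤ c →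
      (famD p).Sat14 (T.L ^ 3 * B₃ * ε₁) (T.L ^ 3 * ε₁) ((β p).bdry V) U₀ → (famD p).In19_21 ε₂ ((β p).bdry V) U₀ U₁ →
      (famD p).CritL ((β p).bdry V) U₀ U₁ →
        ∃ u : (famD p).GT, (famD p).Restricted U₀ u ∧ (T.famAllX p).InU (O₂ * ε₂) ((β p).emb U₀ ((famD p).toAxial U₀ U₁ u)) ∧
          (T.famAllX p).InB V ((β p).emb U₀ ((famD p).toAxial U₀ U₁ u)) ∧
          (T.famAllX p).IsCritical V ((β p).emb U₀ ((famD p).toAxial U₀ U₁ u)))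
    (minimal142 : ∀ (p : Σ n, T.I n) (e ε₁ : ℝ) (V : (T.famAllX p).Bdry) (U₀ : (famD p).Cfg) (U₁ : (famD p).Pert) (u : (famD p).GT),
      e ≤ e₅ → 0 < ε₁ → ε₁ ≤ c →
      (famD p).Sat14 (T.L ^ 3 * B₃ * ε₁) (T.L ^ 3 * ε₁) ((β p).bdry V) U₀ → (famD p).CritL ((β p).bdry V) U₀ U₁ →
      (famD p).Restricted U₀ u → (T.famAllX p).InU e ((β p).emb U₀ ((famD p).toAxial U₀ U₁ u)) →
      (T.famAllX p).InB V ((β p).emb U₀ ((famD p).toAxial U₀ U₁ u)) →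
      (T.famAllX p).IsCritical V ((β p).emb U₀ ((famD p).toAxial U₀ U₁ u)) →
        (T.famAllX p).OnMinimalOrbit e V ((β p).emb U₀ ((famD p).toAxial U₀ U₁ u)))
    (hB₀ : 0 < B₀) (hB₁ : 0 < B₁) (hB₃ : 1 ≤ B₃) (hL : 1 ≤ T.L) (hB₀B₁ : B₀ ≤ 4 * B₁) (hc₁ : 0 < c₁)
    (hO₁ : 0 < O₁) (hO₂ : 0 < O₂) (he₅ : 0 < e₅) (hc : 0 < c)
    (p2 : Prop2Printed B₁ B₃ (T.L ^ 3) c₁ famD) (p5 : Prop5Printed B₁ B₃ (T.L ^ 3) famD) (p6 : Prop6Printed B₀ B₃ (T.L ^ 3) famD) :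
    Prop7From14 T B₃ (T.L ^ 3) := by
  have hC₁ : (1 : ℝ) ≤ T.L ^ 3 := one_le_pow₀ hL
  obtain ⟨a₀, a₁', O, ha₀, ha₁', hO, H⟩ :=
    prop7From14_of_props_thr β laws crit112 axial18 minimal142 hB₀ hB₁ hB₃ hC₁ hB₀B₁ hc₁ hO₁ hO₂ he₅ hc p2 p5 p6
  refine ⟨a₀, a₁', O, ha₀, ha₁', hO, fun n i ε₀ ε₁ hε₁ V hV U₀ h14 => ?_⟩
  exact H ⟨n, i⟩ ε₀ ε₁ hε₁ V hV (bg ⟨n, i⟩ U₀) (hbg14 ⟨n, i⟩ ε₁ V U₀ h14)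

/-- **THE B11 LEAF OF THE TOWER BUNDLE FROM PROPS 2, 3, 4, 5, 6, 9 AND THE LOCATED LEAVES ONLY** — Sect. A by the induction on k
(`B11Thm1.thm1At_allLevels`, `background_of_thm1At` BY NAME; leaves `StepA11`, `StepA13`, `BaseK1`), Sects. B–E by the thresholded
existence steps and the bridge laws, Sect. F by `B11SectFAssembly.Leaves` over all levels (constants B₁, B₃, c₁ shared with Props 2, 5).
[cite: Balaban1985Variational, Thm 1 p.279, Props 2–9 pp.281–309; Sect. A pp.279–280; Sect. F pp.300–305] -/
theorem b11Leaf_tower_full (famAn : (Σ n, T.I n) → AnData) {B₀ B₁ B₃ B₅ C₂ C₃ c₁ c1h c₄ δ₀ β₀ O₁ O₂ e₅ c d B₂ K R₁M₁ a₃ a₄ : ℝ}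
    (hbg14 : ∀ (p : Σ n, T.I n) (ε₁ : ℝ) (V : (T.fam p.1 p.2).Bdry) (U : (T.fam p.1 p.2).Cfg),
      (T.fam p.1 p.2).Sat14 (T.L ^ 3) B₃ ε₁ V U → (famD p).Sat14 (T.L ^ 3 * B₃ * ε₁) (T.L ^ 3 * ε₁) ((β p).bdry V) (bg p U))
    (laws : ∀ p, (β p).Laws (T.L ^ 3) B₃)
    (crit112 : ∀ (p : Σ n, T.I n) (ε₁ : ℝ) (V : (T.famAllX p).Bdry) (U₀ : (famD p).Cfg) (A₁ : (famD p).Fld), 0 < ε₁ → ε₁ ≤ c →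
      (famD p).Sat14 (T.L ^ 3 * B₃ * ε₁) (T.L ^ 3 * ε₁) ((β p).bdry V) U₀ → (famD p).Sol111 ((β p).bdry V) U₀ A₁ →
      (famD p).nMax U₀ A₁ < 3 * B₀ * T.L ^ 3 * B₃ * ε₁ →
        (famD p).CritL ((β p).bdry V) U₀ ((famD p).T112 ((β p).bdry V) U₀ A₁) ∧
          (famD p).In19_21 (O₁ * T.L ^ 3 * B₃ * ε₁) ((β p).bdry V) U₀ ((famD p).T112 ((β p).bdry V) U₀ A₁))
    (axial18 : ∀ (p : Σ n, T.I n) (ε₁ ε₂ : ℝ) (V : (T.famAllX p).Bdry) (U₀ : (famD p).Cfg) (U₁ : (famD p).Pert),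
      0 < ε₁ → ε₁ ≤ c → 0 < ε₂ → ε₂ ≤ c →
      (famD p).Sat14 (T.L ^ 3 * B₃ * ε₁) (T.L ^ 3 * ε₁) ((β p).bdry V) U₀ → (famD p).In19_21 ε₂ ((β p).bdry V) U₀ U₁ →
      (famD p).CritL ((β p).bdry V) U₀ U₁ →
        ∃ u : (famD p).GT, (famD p).Restricted U₀ u ∧ (T.famAllX p).InU (O₂ * ε₂) ((β p).emb U₀ ((famD p).toAxial U₀ U₁ u)) ∧
          (T.famAllX p).InB V ((β p).emb U₀ ((famD p).toAxial U₀ U₁ u)) ∧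
          (T.famAllX p).IsCritical V ((β p).emb U₀ ((famD p).toAxial U₀ U₁ u)))
    (minimal142 : ∀ (p : Σ n, T.I n) (e ε₁ : ℝ) (V : (T.famAllX p).Bdry) (U₀ : (famD p).Cfg) (U₁ : (famD p).Pert) (u : (famD p).GT),
      e ≤ e₅ → 0 < ε₁ → ε₁ ≤ c →
      (famD p).Sat14 (T.L ^ 3 * B₃ * ε₁) (T.L ^ 3 * ε₁) ((β p).bdry V) U₀ → (famD p).CritL ((β p).bdry V) U₀ U₁ →
      (famD p).Restricted U₀ u → (T.famAllX p).InU e ((β p).emb U₀ ((famD p).toAxial U₀ U₁ u)) →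
      (T.famAllX p).InB V ((β p).emb U₀ ((famD p).toAxial U₀ U₁ u)) →
      (T.famAllX p).IsCritical V ((β p).emb U₀ ((famD p).toAxial U₀ U₁ u)) →
        (T.famAllX p).OnMinimalOrbit e V ((β p).emb U₀ ((famD p).toAxial U₀ U₁ u)))
    (lawsA : ∀ n i, (T.fam n i).LawsA) (hA11 : StepA11 T) (hA13 : StepA13 T B₃) (hK1 : BaseK1 T B₃)
    (DF : ∀ p : Σ n, T.I n, CubeData (T.famAllX p)) (hLv : ∀ p, Leaves (T.famAllX p) (DF p) d T.L B₁ B₂ B₃ K R₁M₁ c₁ a₃ a₄)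
    (hd : 1 ≤ d) (hB₂ : 0 < B₂) (hK : 0 < K) (hR : 1 ≤ R₁M₁) (ha₃ : 0 < a₃) (ha₄ : 0 < a₄)
    (hB₀ : 0 < B₀) (hB₁ : 0 < B₁) (hB₃ : 1 ≤ B₃) (hL : 1 ≤ T.L) (hB₀B₁ : B₀ ≤ 4 * B₁) (hc₁ : 0 < c₁)
    (hO₁ : 0 < O₁) (hO₂ : 0 < O₂) (he₅ : 0 < e₅) (hc : 0 < c)
    (p2 : Prop2Printed B₁ B₃ (T.L ^ 3) c₁ famD) (p3 : Prop3Printed (T.L ^ 3) B₃ C₂ C₃ B₀ c1h c₄ δ₀ famD)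
    (p4 : Prop4Printed (T.L ^ 3) B₃ famD) (p5 : Prop5Printed B₁ B₃ (T.L ^ 3) famD) (p6 : Prop6Printed B₀ B₃ (T.L ^ 3) famD)
    (p9 : Prop9Printed B₅ (T.L ^ 3) β₀ δ₀ famAn) :
    B11Leaf
      { I11 := (Σ n, T.I n), famV := T.famAll, famLG := famD, famX := T.famAllX, famAn := famAn, B₀ := B₀, B₁ := B₁, B₃ := B₃,
        B₅ := B₅, C₁ := T.L ^ 3, C₂ := C₂, C₃ := C₃, c₁ := c₁, c1h := c1h, c₄ := c₄, δ₀ := δ₀, β₀ := β₀ } := by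
  have hB₃pos : 0 < B₃ := lt_of_lt_of_le one_pos hB₃
  have hLpos : 0 < T.L := lt_of_lt_of_le one_pos hL
  have plaws : ∀ p : Σ n, T.I n, (T.famAllX p).Laws := fun p => (lawsA p.1 p.2).1
  obtain ⟨p8, sF⟩ := prop8_sectF_of_leavesF T.famAllX DF hLv plaws hd hLpos hB₁ hB₂ hB₃pos hK hR hc₁ ha₃ ha₄
  have h7 : Prop7From14 T B₃ (T.L ^ 3) :=
    prop7From14_tower_thr T famD β bg hbg14 laws crit112 axial18 minimal142 hB₀ hB₁ hB₃ hL hB₀B₁ hc₁ hO₁ hO₂ he₅ hc p2 p5 p6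
  obtain ⟨C, hCB, HC⟩ := thm1At_allLevels T B₃ hB₃pos hL lawsA hA11 hA13 hK1 h7 p8 sF
  have t1 : Thm1Printed T.famAll := (thm1Printed_iff T.famAll).2 ⟨C, fun p => HC p.1 p.2⟩
  -- the Sect. A law for ε₁ ≤ a₁ as a consequence, then the printed Proposition 7 with shrunken constants
  have Hbg : ∀ (n : ℕ) (i : T.I n) (ε₁ : ℝ), 0 < ε₁ → ε₁ ≤ C.a₁ → ∀ V : (T.fam n i).Bdry, (T.fam n i).Reg7 ε₁ V →
      ∃ U₀ : (T.fam n i).Cfg, (T.fam n i).Sat14 (T.L ^ 3) B₃ ε₁ V U₀ := by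
    subst hCB
    exact fun n i ε₁ hε₁ hε₁a V hV => background_of_thm1At T C lawsA hLpos hA11 hA13 hK1 HC n i ε₁ hε₁ hε₁a V hV
  have p7 : Prop7Printed B₃ (T.L ^ 3) T.famAllX := by
    obtain ⟨a₀, a₁', O, ha₀, ha₁', hO, H⟩ := h7
    refine ⟨min a₀ (B₃ * C.a₁), min a₁' C.a₁, O, lt_min ha₀ (mul_pos hB₃pos C.a₁_pos), lt_min ha₁' C.a₁_pos, hO,
      fun p ε₀ ε₁ hε₁ V hV => ⟨?_, ?_⟩⟩
    · intro hε₀ hB₃ε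
      have hε₁a : ε₁ ≤ C.a₁ := by
        have h : B₃ * ε₁ ≤ B₃ * C.a₁ := hB₃ε.trans (hε₀.trans (min_le_right _ _))
        exact le_of_mul_le_mul_left h hB₃pos
      obtain ⟨U₀, h14⟩ := Hbg p.1 p.2 ε₁ hε₁ hε₁a V hV
      exact (H p.1 p.2 ε₀ ε₁ hε₁ V hV U₀ h14).1 (hε₀.trans (min_le_left _ _)) hB₃ε
    · intro hε₁a
      obtain ⟨U₀, h14⟩ := Hbg p.1 p.2 ε₁ hε₁ (hε₁a.trans (min_le_right _ _)) V hV
      exact (H p.1 p.2 ε₀ ε₁ hε₁ V hV U₀ h14).2 (hε₁a.trans (min_le_left _ _))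
  exact ⟨t1, p2, p3, p4, p5, p6, p7, p8, sF, p9⟩

/-- **THE NODE N07 AT A RUN BOUND TO THE TOWER BUNDLE, FROM PROPS 2, 3, 4, 5, 6, 9 AND THE LOCATED LEAVES ONLY** (`b11Leaf_tower_full` under
`w.up P = Upstream.ofPrintedAllXPN X Y ⟨tower bundle⟩ V W`).  Nothing is discharged (the B11 group is free at Stages 1–3).
[cite: Balaban1985Variational, Thm 1 p.279, Props 2–9 pp.281–309] -/
theorem b11_main_tower_full (w : WorldP) (P : B12.RunParams) (X : PrintedCarriersR) (Y : PrintedCarriers9X)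
    (V : PrintedCarriers14R) (W : PrintedCarriers15) (famAn : (Σ n, T.I n) → AnData)
    {B₀ B₁ B₃ B₅ C₂ C₃ c₁ c1h c₄ δ₀ β₀ O₁ O₂ e₅ c d B₂ K R₁M₁ a₃ a₄ : ℝ}
    (hP : w.up P = Upstream.ofPrintedAllXPN X Y
      { I11 := (Σ n, T.I n), famV := T.famAll, famLG := famD, famX := T.famAllX, famAn := famAn, B₀ := B₀, B₁ := B₁, B₃ := B₃,
        B₅ := B₅, C₁ := T.L ^ 3, C₂ := C₂, C₃ := C₃, c₁ := c₁, c1h := c1h, c₄ := c₄, δ₀ := δ₀, β₀ := β₀ } V W)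
    (hbg14 : ∀ (p : Σ n, T.I n) (ε₁ : ℝ) (V : (T.fam p.1 p.2).Bdry) (U : (T.fam p.1 p.2).Cfg),
      (T.fam p.1 p.2).Sat14 (T.L ^ 3) B₃ ε₁ V U → (famD p).Sat14 (T.L ^ 3 * B₃ * ε₁) (T.L ^ 3 * ε₁) ((β p).bdry V) (bg p U))
    (laws : ∀ p, (β p).Laws (T.L ^ 3) B₃)
    (crit112 : ∀ (p : Σ n, T.I n) (ε₁ : ℝ) (V : (T.famAllX p).Bdry) (U₀ : (famD p).Cfg) (A₁ : (famD p).Fld), 0 < ε₁ → ε₁ ≤ c →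
      (famD p).Sat14 (T.L ^ 3 * B₃ * ε₁) (T.L ^ 3 * ε₁) ((β p).bdry V) U₀ → (famD p).Sol111 ((β p).bdry V) U₀ A₁ →
      (famD p).nMax U₀ A₁ < 3 * B₀ * T.L ^ 3 * B₃ * ε₁ →
        (famD p).CritL ((β p).bdry V) U₀ ((famD p).T112 ((β p).bdry V) U₀ A₁) ∧
          (famD p).In19_21 (O₁ * T.L ^ 3 * B₃ * ε₁) ((β p).bdry V) U₀ ((famD p).T112 ((β p).bdry V) U₀ A₁))
    (axial18 : ∀ (p : Σ n, T.I n) (ε₁ ε₂ : ℝ) (V : (T.famAllX p).Bdry) (U₀ : (famD p).Cfg) (U₁ : (famD p).Pert),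
      0 < ε₁ → ε₁ ≤ c → 0 < ε₂ → ε₂ ≤ c →
      (famD p).Sat14 (T.L ^ 3 * B₃ * ε₁) (T.L ^ 3 * ε₁) ((β p).bdry V) U₀ → (famD p).In19_21 ε₂ ((β p).bdry V) U₀ U₁ →
      (famD p).CritL ((β p).bdry V) U₀ U₁ →
        ∃ u : (famD p).GT, (famD p).Restricted U₀ u ∧ (T.famAllX p).InU (O₂ * ε₂) ((β p).emb U₀ ((famD p).toAxial U₀ U₁ u)) ∧
          (T.famAllX p).InB V ((β p).emb U₀ ((famD p).toAxial U₀ U₁ u)) ∧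
          (T.famAllX p).IsCritical V ((β p).emb U₀ ((famD p).toAxial U₀ U₁ u)))
    (minimal142 : ∀ (p : Σ n, T.I n) (e ε₁ : ℝ) (V : (T.famAllX p).Bdry) (U₀ : (famD p).Cfg) (U₁ : (famD p).Pert) (u : (famD p).GT),
      e ≤ e₅ → 0 < ε₁ → ε₁ ≤ c →
      (famD p).Sat14 (T.L ^ 3 * B₃ * ε₁) (T.L ^ 3 * ε₁) ((β p).bdry V) U₀ → (famD p).CritL ((β p).bdry V) U₀ U₁ →
      (famD p).Restricted U₀ u → (T.famAllX p).InU e ((β p).emb U₀ ((famD p).toAxial U₀ U₁ u)) →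
      (T.famAllX p).InB V ((β p).emb U₀ ((famD p).toAxial U₀ U₁ u)) →
      (T.famAllX p).IsCritical V ((β p).emb U₀ ((famD p).toAxial U₀ U₁ u)) →
        (T.famAllX p).OnMinimalOrbit e V ((β p).emb U₀ ((famD p).toAxial U₀ U₁ u)))
    (lawsA : ∀ n i, (T.fam n i).LawsA) (hA11 : StepA11 T) (hA13 : StepA13 T B₃) (hK1 : BaseK1 T B₃)
    (DF : ∀ p : Σ n, T.I n, CubeData (T.famAllX p)) (hLv : ∀ p, Leaves (T.famAllX p) (DF p) d T.L B₁ B₂ B₃ K R₁M₁ c₁ a₃ a₄)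
    (hd : 1 ≤ d) (hB₂ : 0 < B₂) (hK : 0 < K) (hR : 1 ≤ R₁M₁) (ha₃ : 0 < a₃) (ha₄ : 0 < a₄)
    (hB₀ : 0 < B₀) (hB₁ : 0 < B₁) (hB₃ : 1 ≤ B₃) (hL : 1 ≤ T.L) (hB₀B₁ : B₀ ≤ 4 * B₁) (hc₁ : 0 < c₁)
    (hO₁ : 0 < O₁) (hO₂ : 0 < O₂) (he₅ : 0 < e₅) (hc : 0 < c)
    (p2 : Prop2Printed B₁ B₃ (T.L ^ 3) c₁ famD) (p3 : Prop3Printed (T.L ^ 3) B₃ C₂ C₃ B₀ c1h c₄ δ₀ famD)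
    (p4 : Prop4Printed (T.L ^ 3) B₃ famD) (p5 : Prop5Printed B₁ B₃ (T.L ^ 3) famD) (p6 : Prop6Printed B₀ B₃ (T.L ^ 3) famD)
    (p9 : Prop9Printed B₅ (T.L ^ 3) β₀ δ₀ famAn) :
    Dag.B11_main (leavesP w P) := by
  show (w.up P).b5 → (w.up P).b6 → (w.up P).b7 → (w.up P).b8 → (w.up P).b9 → (w.up P).b11
  rw [hP]
  exact fun _ _ _ _ _ => b11Leaf_tower_full T famD β bg famAn hbg14 laws crit112 axial18 minimal142 lawsA hA11 hA13 hK1 DF hLv hd hB₂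
    hK hR ha₃ ha₄ hB₀ hB₁ hB₃ hL hB₀B₁ hc₁ hO₁ hO₂ he₅ hc p2 p3 p4 p5 p6 p9

end TowerFull

end Literature.MathematicalPhysics.QuantumFieldTheory.Balaban1983to89.B11LeafKnitFull
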